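import Literature.NumberTheory.Automorphic.LocalUnitaryGroupSimilitudeLevel
import Literature.NumberTheory.Automorphic.LocalHermitianPlaneIsotropic
import Literature.NumberTheory.Automorphic.Liu2021.LemD1BinaryIsotropyOfPlace
import HarnessLib

/-!
# The local identifications `ψ_v : U(H)(L⁺_v) ≃ₜ* U(Φ_N)(L⁺_v)` AWAY FROM A FINITE SET, for every rank `N`, and the
# rank-2 package: conjugation at every ISOTROPIC place, level matching off a finite `S₀ ⊇ T`
# (Rogawski (1990), §14.1–14.2 pp. 232–233 and §3.8 p. 30; Platonov–Rapinchuk (1994), §2.3, §5.1)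

Topic `NumberTheory/Automorphic`; namespace `Literature.NumberTheory.Automorphic.UnitaryGroup`.  THEOREMS ONLY (no definition, no
named fact, no instance, no notation, no `sorry`).  Rank-2 (and rank-generic) sequel to ★ `LocalUnitaryGroupSimilitudeLevel` (§4 there
is the rank-3 package `exists_psi_corresponds_forall_levelMatching`: for an anisotropic hermitian `H ∈ M₃(L)` ONE family `ψ_v` at ALL
finite `v`, conjugation everywhere, level-preserving off a finite `S₀`) and to ★ `LocalHermitianPlaneIsotropic` (rank 2: at a finite
place where the hermitian PLANE `H_v` is isotropic, `U(H)(L⁺_v) ≃ₜ* U(Φ₂)(L⁺_v)`).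

**Why (cell `hodgecm-mathlib`, the `N = 2` edition of the quasi-split comparison letter T1g(N, H); F0P3a SPEC-ed1.19c §7,
director D1 s454∕s465).**  The letter has the shape (i) «AWAY FROM a finite `S`: level-matching local isomorphisms
`ψ_v : U(H)(L⁺_v) ≃ₜ* U(Φ_N)(L⁺_v)` with class correspondence both ways» + (ii) «AT `S`: a local inner-transfer datum».  In rank `3`
one may take `S = ∅` for (ii) ([Rogawski1990, §14.2 (i)–(iii)]: odd rank); in rank `2` the set `S` must contain the set `T` of
finite places where the plane `H_v` is ANISOTROPIC (there `U(H)(L⁺_v)` is compact, ★ `compactSpace_cmDatum_local_of_not_isIsotropic`,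
and `T ≠ ∅` is forced when `[L⁺:ℚ]` is even, ★ `Liu2021.RemD5CompanionParity.even_ncard_not_isIsotropic_iff`).  This file states (i)
VERBATIM for every `N` on the tree's carriers and, for `N = 2`, packages the conjugation data at EVERY place outside `T` together with
the level matching off a finite `S₀ ⊇ T`.

* §1 (any `N`, CM packaging of ★ `eventually_exists_conj_levelMatching`): **`exists_finset_forall_exists_conj_levelMatching`** — for
  `H ∈ M_N(L)` hermitian with `det H` a unit there is a finite `S₀` such that for every `v ∉ S₀` some
  `ψ_v : (cmDatum L N H).Local v ≃ₜ* (cmDatum L N Φ_N).Local v` is conjugation by an `S_v ∈ GL_N(L ⊗ L⁺_v)` on matrices (hence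
  `γ′ ↔ ψ_v γ′` and `ψ_v⁻¹ γ ↔ γ`, ★ `corresponds_of_coe_eq_conj`) AND matches the integral levels
  `ψ_v g ∈ U(Φ_N)(𝒪_v) ↔ g ∈ U(H)(𝒪_v)`; anisotropic variant `…_of_anisotropic`.
* §2 (`N = 2`, `H ∈ M₂(L)` hermitian with `det H ≠ 0`, a finite `v` at which `H` is isotropic above every NON-SPLIT `w ∣ v`):
  `exists_isUnit_formCongr_cmDatum_antidiagTwo_of_isotropic` — a local similitude `ᵗ(T̄) · H_v · T = a • (Φ₂)_v` (rank-2 twin of ★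
  `exists_isUnit_formCongr_cmDatum_antidiagThree`; non-split: ★ `exists_isUnit_formCongr_map_eq_smul_antidiag_two_of_isotropic`, split: ★
  `exists_isUnit_formCongr_eq_smul_of_split`), and **`exists_cmDatum_localEquiv_corresponds_two_of_isotropic`** — the induced
  `e : U(H)(L⁺_v) ≃ₜ* U(Φ₂)(L⁺_v)`, `e g = T⁻¹ g T`, with `γ′ ↔ e γ′` and `e⁻¹ γ ↔ γ` (twin of ★ `exists_cmDatum_localEquiv_corresponds`);
  `…_of_isIsotropic` — the same with the isotropy hypothesis in the currency `LemD1.IsIsotropic` of the standing data of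
  [Liu2021, App. D §D.1] (★ `isIsotropic_standingData_iff_localGram`).
* §3 (`N = 2`, PACKAGED): **`exists_finset_rankTwo_levelMatching_of_finite`** — if `T = {v ∣ H_v anisotropic}` is finite then there is a
  finite `S₀ ⊇ T` with (a) for `v ∉ S₀`: some `ψ_v` that is conjugation, corresponds both ways and matches the levels; (b) for every
  `v ∉ T`: some `e_v` that is conjugation and corresponds both ways; and its discharge **`exists_finset_rankTwo_levelMatching_diagonal`**
  for `H = diag(dJ₀, dJ₁)` (the binders of ★ `even_ncard_not_isIsotropic_iff`, i.e. the `T` of the cell's P5 letters; `T` finite by Hilbert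
  reciprocity, ★ `LemD1OfPlace.finite_setOf_not_isIsotropic`).

Statements are `∀ v, ∃ ψ_v` (SPEC §7 (i) as printed), not one dependent family: at `v ∈ T` no `ψ_v` exists, so a total family is not
available in rank 2; a consumer kit chooses.  HONEST LABEL: HC_CM is proved only modulo the printed citations until rung 0 closes; this
file is unconditional and proves no cell binder.

## References
* [Rogawski1990] J. Rogawski, *Automorphic Representations of Unitary Groups in Three Variables*, Ann. of Math. Stud. 123 (1990),
  §14.1–14.2 pp. 232–233 (the inner isomorphism `ψ`, `K_v ≃ K′_v` off `S₀ ∪ S`), §3.8 p. 30 (unitary groups in two variables).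
* [PlatonovRapinchuk1994] V. Platonov, A. Rapinchuk, *Algebraic Groups and Number Theory* (1994), §2.3, §5.1.
* [Liu2021] Y. Liu, Camb. J. Math. 9 (2021), App. D Lem. D.1 (4) (isotropic ∕ anisotropic `V` at `n = 2`).
* [Omeara1963] O. T. O'Meara, *Introduction to Quadratic Forms* (1963), §71 Thm. 71:18 (Hilbert reciprocity).
-/

set_option autoImplicit false

noncomputable section

open NumberField IsDedekindDomain Filter
open Literature.NumberTheory.Rogawski1990 (Corresponds corresponds_comm)

open scoped Matrix MatrixGroups

namespace Literature.NumberTheory.Automorphic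

namespace UnitaryGroup

variable (L : Type) [Field L] [NumberField L] [IsCMField L]

/-! ## §1 Any rank: (i) of the letter T1g(N, H) — conjugation + class correspondence + level matching off a finite set -/

section AnyRank

variable {N : ℕ}

/-- **T1g(N, H) (i), away from a finite set** ([Rogawski1990, §14.2 p. 233]: «for `v ∉ S₀ ∪ S` … `K_v ≃ K′_v`»; [PlatonovRapinchuk1994,
§5.1]): for `H ∈ M_N(L)` hermitian (`ᵗH̄ = H`) with `det H` a unit there is a finite set `S₀` of finite places of `L⁺` such that for
every `v ∉ S₀` some `ψ_v : U(H)(L⁺_v) ≃ₜ* U(Φ_N)(L⁺_v)` is CONJUGATION `g ↦ S_v⁻¹ g S_v` by an `S_v ∈ GL_N(L ⊗ L⁺_v)`, satisfies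
`γ′ ↔ ψ_v γ′` and `ψ_v⁻¹ γ ↔ γ` (★ `Rogawski1990.Corresponds`), and matches the integral levels `ψ_v g ∈ U(Φ_N)(𝒪_v) ↔ g ∈ U(H)(𝒪_v)`.
CM packaging of ★ `eventually_exists_conj_levelMatching` + ★ `corresponds_of_coe_eq_conj`. [cite: Rogawski1990, §14.2 p. 233]
[cite: PlatonovRapinchuk1994, §5.1] -/
theorem exists_finset_forall_exists_conj_levelMatching (H : Matrix (Fin N) (Fin N) L)
    (hH : (H.map (cmConjRingHom L))ᵀ = H) (hHd : IsUnit H.det) :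
    ∃ S₀ : Finset (HeightOneSpectrum (𝓞 ↥(maximalRealSubfield L))), ∀ v ∉ S₀,
      ∃ ψ : (cmDatum L N H).Local v ≃ₜ*
          (cmDatum L N (Matrix.of fun i j : Fin N => if i.val + j.val + 1 = N then (1 : L) else 0)).Local v,
        (∃ S : GL (Fin N) (LocalRing L v), ∀ g : (cmDatum L N H).Local v,
          ((ψ g).val : GL (Fin N) (LocalRing L v)) = S⁻¹ * g.val * S) ∧
        (∀ γ' : (cmDatum L N H).Local v,
          Corresponds (conjLocal L (IsCMField.complexConj L) v) ((adelicForm L N H).map (adeleToLocal L v))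
            ((adelicForm L N (Matrix.of fun i j : Fin N => if i.val + j.val + 1 = N then (1 : L) else 0)).map (adeleToLocal L v))
            γ' (ψ γ')) ∧
        (∀ γ : (cmDatum L N (Matrix.of fun i j : Fin N => if i.val + j.val + 1 = N then (1 : L) else 0)).Local v,
          Corresponds (conjLocal L (IsCMField.complexConj L) v) ((adelicForm L N H).map (adeleToLocal L v))
            ((adelicForm L N (Matrix.of fun i j : Fin N => if i.val + j.val + 1 = N then (1 : L) else 0)).map (adeleToLocal L v))
            (ψ.symm γ) γ) ∧
        ∀ g, ψ g ∈ cmLocalIntegralLevel L N (Matrix.of fun i j : Fin N => if i.val + j.val + 1 = N then (1 : L) else 0) v ↔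
          g ∈ cmLocalIntegralLevel L N H v := by
  classical
  have hev := eventually_exists_conj_levelMatching (IsCMField.complexConj L) (N := N) (J := H) (IsCMField.complexConj_ne_one L)
    ((map_cmConjRingHom_eq_map_complexConj L H) ▸ hH) hHd
  rw [Filter.eventually_cofinite] at hev
  refine ⟨hev.toFinset, fun v hv => ?_⟩
  rw [Set.Finite.mem_toFinset] at hv
  obtain ⟨ψ, ⟨S, hS⟩, hlev⟩ := not_not.1 hv
  exact ⟨ψ, ⟨S, hS⟩, fun γ' => corresponds_of_coe_eq_conj (IsCMField.complexConj L) v ψ S hS γ',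
    fun γ => corresponds_symm_of_coe_eq_conj (IsCMField.complexConj L) v ψ S hS γ, hlev⟩

/-- The same for an ANISOTROPIC hermitian `H` (the binders of the inner forms of the cell's letters; anisotropic ⇒ `det H ≠ 0`,
★ `Godement.det_ne_zero_of_anisotropic`). [cite: Rogawski1990, §14.2 p. 233] -/
theorem exists_finset_forall_exists_conj_levelMatching_of_anisotropic (H : Matrix (Fin N) (Fin N) L)
    (hanis : ∀ x : Fin N → L, Literature.AlgebraicGeometry.ShimuraVarieties.hermForm (cmConjRingHom L) H x x = 0 → x = 0)
    (hH : (H.map (cmConjRingHom L))ᵀ = H) :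
    ∃ S₀ : Finset (HeightOneSpectrum (𝓞 ↥(maximalRealSubfield L))), ∀ v ∉ S₀,
      ∃ ψ : (cmDatum L N H).Local v ≃ₜ*
          (cmDatum L N (Matrix.of fun i j : Fin N => if i.val + j.val + 1 = N then (1 : L) else 0)).Local v,
        (∃ S : GL (Fin N) (LocalRing L v), ∀ g : (cmDatum L N H).Local v,
          ((ψ g).val : GL (Fin N) (LocalRing L v)) = S⁻¹ * g.val * S) ∧
        (∀ γ' : (cmDatum L N H).Local v,
          Corresponds (conjLocal L (IsCMField.complexConj L) v) ((adelicForm L N H).map (adeleToLocal L v))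
            ((adelicForm L N (Matrix.of fun i j : Fin N => if i.val + j.val + 1 = N then (1 : L) else 0)).map (adeleToLocal L v))
            γ' (ψ γ')) ∧
        (∀ γ : (cmDatum L N (Matrix.of fun i j : Fin N => if i.val + j.val + 1 = N then (1 : L) else 0)).Local v,
          Corresponds (conjLocal L (IsCMField.complexConj L) v) ((adelicForm L N H).map (adeleToLocal L v))
            ((adelicForm L N (Matrix.of fun i j : Fin N => if i.val + j.val + 1 = N then (1 : L) else 0)).map (adeleToLocal L v))
            (ψ.symm γ) γ) ∧
        ∀ g, ψ g ∈ cmLocalIntegralLevel L N (Matrix.of fun i j : Fin N => if i.val + j.val + 1 = N then (1 : L) else 0) v ↔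
          g ∈ cmLocalIntegralLevel L N H v :=
  exists_finset_forall_exists_conj_levelMatching L H hH (isUnit_iff_ne_zero.2 (Godement.det_ne_zero_of_anisotropic L H hanis))

end AnyRank

/-! ## §2 Rank 2: a similitude onto `a • Φ₂`, and the induced `e : U(H)(L⁺_v) ≃ₜ* U(Φ₂)(L⁺_v)` with `γ′ ↔ e γ′`, at every ISOTROPIC place -/

section RankTwo

/-- **A local similitude onto the split form at every place OUTSIDE `T`** ([Rogawski1990, §3.8 p. 30]: `H′_ξ` is the quasi-split
`U(2)` iff `ξ ∈ N(E_v^×)`; [PlatonovRapinchuk1994, §2.3]): for `H ∈ M₂(L)` hermitian with `det H ≠ 0` and a finite place `v` of `L⁺`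
such that `H_v` is isotropic above every NON-SPLIT `w ∣ v`, there are `T ∈ GL₂(L ⊗ L⁺_v)` and a unit `a` with `ᵗ(T̄) · H_v · T = a • (Φ₂)_v`,
`Φ₂ = antidiag(1,1)`.  Non-split `v`: ★ `exists_isUnit_formCongr_map_eq_smul_antidiag_two_of_isotropic` (`a = 1`); split `v`: ★
`exists_isUnit_formCongr_eq_smul_of_split`.  Rank-2 twin of ★ `exists_isUnit_formCongr_cmDatum_antidiagThree` (where no place is excluded).
[cite: Rogawski1990, §3.8 p. 30] [cite: PlatonovRapinchuk1994, §2.3] -/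
theorem exists_isUnit_formCongr_cmDatum_antidiagTwo_of_isotropic (H : Matrix (Fin 2) (Fin 2) L)
    (hH : (H.map (cmConjRingHom L))ᵀ = H) (hHd : H.det ≠ 0) (v : HeightOneSpectrum (𝓞 ↥(maximalRealSubfield L)))
    (hiso : ∀ w : PlacesOver L v, IsCMField.complexConj L • w.1 = w.1 →
      ∃ r : Fin 2 → LocalRing L v, r ≠ 0 ∧
        hermForm (conjLocal L (IsCMField.complexConj L) v) ((adelicForm L 2 H).map (adeleToLocal L v)) r r = 0) :
    ∃ (T : GL (Fin 2) (LocalRing L v)) (a : LocalRing L v), IsUnit a ∧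
      formCongr (conjLocal L (IsCMField.complexConj L) v) T (H.map (algebraMap L (LocalRing L v))) =
        a • (Matrix.of fun i j : Fin 2 => if i.val + j.val + 1 = 2 then (1 : L) else 0).map (algebraMap L (LocalRing L v)) := by
  obtain ⟨w⟩ : Nonempty (PlacesOver L v) := inferInstance
  by_cases hw : IsCMField.complexConj L • w.1 = w.1
  · exact exists_isUnit_formCongr_map_eq_smul_antidiag_two_of_isotropic L (IsCMField.complexConj L)
      (IsCMField.complexConj_ne_one L) H ((map_cmConjRingHom_eq_map_complexConj L H) ▸ hH) hHd w hw (hiso w hw)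
  · obtain ⟨T, a, ha, -, h⟩ := exists_isUnit_formCongr_eq_smul_of_split (IsCMField.complexConj L)
      (IsCMField.complexConj_ne_one L) ((map_cmConjRingHom_eq_map_complexConj L H) ▸ hH) (antidiagOne_isHermitian L 2)
      (isUnit_iff_ne_zero.2 hHd) (isUnit_antidiagOne_det L 2) w hw
    exact ⟨T, a, ha, h⟩

/-- **The identification `e_v : U(H)(L⁺_v) ≃ₜ* U(Φ₂)(L⁺_v)` as conjugation by a similitude, with `γ′ ↔ e_v γ′`, at every place outside
`T`** — the rank-2 twin of ★ `exists_cmDatum_localEquiv_corresponds` ([Rogawski1990, §14.1–14.2 p. 232]: the inner isomorphism `ψ` and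
(14.2.1) at the finite places): for `H ∈ M₂(L)` hermitian with `det H ≠ 0` and `v` with `H_v` isotropic above every non-split `w ∣ v`
there are `T ∈ GL₂(L ⊗ L⁺_v)` and `e` with `e g = T⁻¹ g T` on matrices, `γ′ ↔ e γ′` for every `γ′ ∈ U(H)(L⁺_v)` and `e⁻¹ γ ↔ γ` for every
`γ ∈ U(Φ₂)(L⁺_v)`; `e = (cmDatumLocalCongr L v T ha h).symm` for the similitude of `exists_isUnit_formCongr_cmDatum_antidiagTwo_of_isotropic`.
[cite: Rogawski1990, §14.2 (14.2.1) p. 232] [cite: PlatonovRapinchuk1994, §2.3] -/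
theorem exists_cmDatum_localEquiv_corresponds_two_of_isotropic (H : Matrix (Fin 2) (Fin 2) L)
    (hH : (H.map (cmConjRingHom L))ᵀ = H) (hHd : H.det ≠ 0) (v : HeightOneSpectrum (𝓞 ↥(maximalRealSubfield L)))
    (hiso : ∀ w : PlacesOver L v, IsCMField.complexConj L • w.1 = w.1 →
      ∃ r : Fin 2 → LocalRing L v, r ≠ 0 ∧
        hermForm (conjLocal L (IsCMField.complexConj L) v) ((adelicForm L 2 H).map (adeleToLocal L v)) r r = 0) :
    ∃ (T : GL (Fin 2) (LocalRing L v)) (e : (cmDatum L 2 H).Local v ≃ₜ*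
        (cmDatum L 2 (Matrix.of fun i j : Fin 2 => if i.val + j.val + 1 = 2 then (1 : L) else 0)).Local v),
      (∀ g : (cmDatum L 2 H).Local v, ((e g).val : GL (Fin 2) (LocalRing L v)) = T⁻¹ * g.val * T) ∧
      (∀ γ' : (cmDatum L 2 H).Local v,
        Corresponds (conjLocal L (IsCMField.complexConj L) v) ((adelicForm L 2 H).map (adeleToLocal L v))
          ((adelicForm L 2 (Matrix.of fun i j : Fin 2 => if i.val + j.val + 1 = 2 then (1 : L) else 0)).map (adeleToLocal L v))
          γ' (e γ')) ∧
      ∀ γ : (cmDatum L 2 (Matrix.of fun i j : Fin 2 => if i.val + j.val + 1 = 2 then (1 : L) else 0)).Local v,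
        Corresponds (conjLocal L (IsCMField.complexConj L) v) ((adelicForm L 2 H).map (adeleToLocal L v))
          ((adelicForm L 2 (Matrix.of fun i j : Fin 2 => if i.val + j.val + 1 = 2 then (1 : L) else 0)).map (adeleToLocal L v))
          (e.symm γ) γ := by
  obtain ⟨T, a, ha, h⟩ := exists_isUnit_formCongr_cmDatum_antidiagTwo_of_isotropic L H hH hHd v hiso
  refine ⟨T, (cmDatumLocalCongr L v T ha h).symm, fun g => rfl,
    fun γ' => corresponds_comm.1 (corresponds_cmDatumLocalCongr_symm L v T ha h γ'), fun γ => ?_⟩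
  rw [ContinuousMulEquiv.symm_symm]
  exact corresponds_comm.1 (corresponds_cmDatumLocalCongr L v T ha h γ)

/-- The same with the isotropy hypothesis in the currency of the standing data of [Liu2021, App. D §D.1] AT THE PLACE `v`
(`Liu2021.LemD1.IsIsotropic (Liu2021.LemD1OfPlace.standingData L v c̄ 2 H …)`, ★ `isIsotropic_standingData_iff_localGram`; the currency in which ★
`RemD5CompanionParity.even_ncard_not_isIsotropic_iff` counts the anisotropic set `T`): for any purely imaginary `δ ≠ 0` of `L` and every
finite `v` with `H_v` isotropic above each non-split `w ∣ v`, `U(H)(L⁺_v) ≃ₜ* U(Φ₂)(L⁺_v)` by a conjugation `e`, `γ′ ↔ e γ′`, `e⁻¹ γ ↔ γ`.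
[cite: Rogawski1990, §14.2 (14.2.1) p. 232] [cite: Liu2021, App. D Lem. D.1 (4)] -/
theorem exists_cmDatum_localEquiv_corresponds_two_of_isIsotropic (H : Matrix (Fin 2) (Fin 2) L)
    (hH : (H.map (cmConjRingHom L))ᵀ = H) (hHd : H.det ≠ 0) {δ : L} (hcδ : IsCMField.complexConj L δ = -δ) (hδ : δ ≠ 0)
    (v : HeightOneSpectrum (𝓞 ↥(maximalRealSubfield L)))
    (hiso : ∀ w : PlacesOver L v, IsCMField.complexConj L • w.1 = w.1 →
      Liu2021.LemD1.IsIsotropic (Liu2021.LemD1OfPlace.standingData L v (IsCMField.complexConj L) 2 H hcδ hδ le_rfl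
        ((map_cmConjRingHom_eq_map_complexConj L H) ▸ hH) hHd)) :
    ∃ (T : GL (Fin 2) (LocalRing L v)) (e : (cmDatum L 2 H).Local v ≃ₜ*
        (cmDatum L 2 (Matrix.of fun i j : Fin 2 => if i.val + j.val + 1 = 2 then (1 : L) else 0)).Local v),
      (∀ g : (cmDatum L 2 H).Local v, ((e g).val : GL (Fin 2) (LocalRing L v)) = T⁻¹ * g.val * T) ∧
      (∀ γ' : (cmDatum L 2 H).Local v,
        Corresponds (conjLocal L (IsCMField.complexConj L) v) ((adelicForm L 2 H).map (adeleToLocal L v))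
          ((adelicForm L 2 (Matrix.of fun i j : Fin 2 => if i.val + j.val + 1 = 2 then (1 : L) else 0)).map (adeleToLocal L v))
          γ' (e γ')) ∧
      ∀ γ : (cmDatum L 2 (Matrix.of fun i j : Fin 2 => if i.val + j.val + 1 = 2 then (1 : L) else 0)).Local v,
        Corresponds (conjLocal L (IsCMField.complexConj L) v) ((adelicForm L 2 H).map (adeleToLocal L v))
          ((adelicForm L 2 (Matrix.of fun i j : Fin 2 => if i.val + j.val + 1 = 2 then (1 : L) else 0)).map (adeleToLocal L v))
          (e.symm γ) γ :=
  exists_cmDatum_localEquiv_corresponds_two_of_isotropic L H hH hHd v fun w hw =>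
    (isIsotropic_standingData_iff_localGram L (IsCMField.complexConj L) H v hcδ hδ le_rfl
      ((map_cmConjRingHom_eq_map_complexConj L H) ▸ hH) hHd).1 (hiso w hw)

end RankTwo

/-! ## §3 Rank 2, PACKAGED: a finite `S₀ ⊇ T`, level matching off `S₀`, conjugation + class correspondence off `T` -/

section Package

/-- **(Ψ₂) The rank-2 letter T1g(2, H) (i), with the exceptional set as an OUTPUT `S₀ ⊇ T`** ([Rogawski1990, §14.2 p. 232–233] read in
rank 2; [PlatonovRapinchuk1994, §5.1]).  Let `H ∈ M₂(L)` be hermitian with `det H ≠ 0`, `δ` a purely imaginary non-zero element of `L`, and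
`T` the set of finite places `v` of `L⁺` where the local plane is ANISOTROPIC (`¬ LemD1.IsIsotropic` of the standing data at `v`).  If `T` is
finite, there is a finite `S₀ ⊇ T` such that: (a) for every `v ∉ S₀` some `ψ_v : U(H)(L⁺_v) ≃ₜ* U(Φ₂)(L⁺_v)` is conjugation by an
`S_v ∈ GL₂(L ⊗ L⁺_v)`, satisfies `γ′ ↔ ψ_v γ′`, `ψ_v⁻¹ γ ↔ γ` and matches the levels `ψ_v g ∈ U(Φ₂)(𝒪_v) ↔ g ∈ U(H)(𝒪_v)` (§1); (b) for
every `v ∉ T` some `e_v : U(H)(L⁺_v) ≃ₜ* U(Φ₂)(L⁺_v)` is conjugation `g ↦ T_v⁻¹ g T_v` and satisfies `γ′ ↔ e_v γ′`, `e_v⁻¹ γ ↔ γ` (§2) —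
so on `S₀ ∖ T` the local inner-transfer datum is the trivial one.  At `v ∈ T` no such `e_v` exists (`U(H)(L⁺_v)` is compact).
[cite: Rogawski1990, §14.2 p. 233] [cite: PlatonovRapinchuk1994, §5.1] -/
theorem exists_finset_rankTwo_levelMatching_of_finite (H : Matrix (Fin 2) (Fin 2) L)
    (hH : (H.map (cmConjRingHom L))ᵀ = H) (hHd : H.det ≠ 0) {δ : L} (hcδ : IsCMField.complexConj L δ = -δ) (hδ : δ ≠ 0)
    (hT : {v : HeightOneSpectrum (𝓞 ↥(maximalRealSubfield L)) |
      ¬ Liu2021.LemD1.IsIsotropic (Liu2021.LemD1OfPlace.standingData L v (IsCMField.complexConj L) 2 H hcδ hδ le_rfl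
        ((map_cmConjRingHom_eq_map_complexConj L H) ▸ hH) hHd)}.Finite) :
    ∃ S₀ : Finset (HeightOneSpectrum (𝓞 ↥(maximalRealSubfield L))),
      {v : HeightOneSpectrum (𝓞 ↥(maximalRealSubfield L)) |
        ¬ Liu2021.LemD1.IsIsotropic (Liu2021.LemD1OfPlace.standingData L v (IsCMField.complexConj L) 2 H hcδ hδ le_rfl
          ((map_cmConjRingHom_eq_map_complexConj L H) ▸ hH) hHd)} ⊆ ↑S₀ ∧
      (∀ v ∉ S₀, ∃ ψ : (cmDatum L 2 H).Local v ≃ₜ*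
          (cmDatum L 2 (Matrix.of fun i j : Fin 2 => if i.val + j.val + 1 = 2 then (1 : L) else 0)).Local v,
        (∃ S : GL (Fin 2) (LocalRing L v), ∀ g : (cmDatum L 2 H).Local v,
          ((ψ g).val : GL (Fin 2) (LocalRing L v)) = S⁻¹ * g.val * S) ∧
        (∀ γ' : (cmDatum L 2 H).Local v,
          Corresponds (conjLocal L (IsCMField.complexConj L) v) ((adelicForm L 2 H).map (adeleToLocal L v))
            ((adelicForm L 2 (Matrix.of fun i j : Fin 2 => if i.val + j.val + 1 = 2 then (1 : L) else 0)).map (adeleToLocal L v))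
            γ' (ψ γ')) ∧
        (∀ γ : (cmDatum L 2 (Matrix.of fun i j : Fin 2 => if i.val + j.val + 1 = 2 then (1 : L) else 0)).Local v,
          Corresponds (conjLocal L (IsCMField.complexConj L) v) ((adelicForm L 2 H).map (adeleToLocal L v))
            ((adelicForm L 2 (Matrix.of fun i j : Fin 2 => if i.val + j.val + 1 = 2 then (1 : L) else 0)).map (adeleToLocal L v))
            (ψ.symm γ) γ) ∧
        ∀ g, ψ g ∈ cmLocalIntegralLevel L 2 (Matrix.of fun i j : Fin 2 => if i.val + j.val + 1 = 2 then (1 : L) else 0) v ↔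
          g ∈ cmLocalIntegralLevel L 2 H v) ∧
      ∀ v, Liu2021.LemD1.IsIsotropic (Liu2021.LemD1OfPlace.standingData L v (IsCMField.complexConj L) 2 H hcδ hδ le_rfl
          ((map_cmConjRingHom_eq_map_complexConj L H) ▸ hH) hHd) →
        ∃ (T : GL (Fin 2) (LocalRing L v)) (e : (cmDatum L 2 H).Local v ≃ₜ*
            (cmDatum L 2 (Matrix.of fun i j : Fin 2 => if i.val + j.val + 1 = 2 then (1 : L) else 0)).Local v),
          (∀ g : (cmDatum L 2 H).Local v, ((e g).val : GL (Fin 2) (LocalRing L v)) = T⁻¹ * g.val * T) ∧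
          (∀ γ' : (cmDatum L 2 H).Local v,
            Corresponds (conjLocal L (IsCMField.complexConj L) v) ((adelicForm L 2 H).map (adeleToLocal L v))
              ((adelicForm L 2 (Matrix.of fun i j : Fin 2 => if i.val + j.val + 1 = 2 then (1 : L) else 0)).map (adeleToLocal L v))
              γ' (e γ')) ∧
          ∀ γ : (cmDatum L 2 (Matrix.of fun i j : Fin 2 => if i.val + j.val + 1 = 2 then (1 : L) else 0)).Local v,
            Corresponds (conjLocal L (IsCMField.complexConj L) v) ((adelicForm L 2 H).map (adeleToLocal L v))
              ((adelicForm L 2 (Matrix.of fun i j : Fin 2 => if i.val + j.val + 1 = 2 then (1 : L) else 0)).map (adeleToLocal L v))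
              (e.symm γ) γ := by
  classical
  obtain ⟨S₁, hS₁⟩ := exists_finset_forall_exists_conj_levelMatching L H hH (isUnit_iff_ne_zero.2 hHd)
  refine ⟨S₁ ∪ hT.toFinset, fun v hv => ?_, fun v hv => hS₁ v fun h => hv (Finset.mem_union_left _ h), fun v hv => ?_⟩
  · rw [Finset.coe_union, Set.Finite.coe_toFinset]
    exact Set.mem_union_right _ hv
  · exact exists_cmDatum_localEquiv_corresponds_two_of_isIsotropic L H hH hHd hcδ hδ v fun _ _ => hv

/-- **(Ψ₂) for the DIAGONAL planes of the cell's P5 letters** — `H = diag(dJ₀, dJ₁)` with `dJᵢ ∈ L⁺` non-zero (the binders of ★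
`RemD5CompanionParity.even_ncard_not_isIsotropic_iff`; `T` below is LITERALLY its set of anisotropic finite places): `T` is finite by
Hilbert reciprocity for `(δ², −dJ₀dJ₁)` (★ `LemD1OfPlace.finite_setOf_not_isIsotropic`, [Omeara1963, §71 Thm. 71:18]), so the package of
`exists_finset_rankTwo_levelMatching_of_finite` holds unconditionally: a finite `S₀ ⊇ T`, conjugation + class correspondence + level
matching off `S₀`, conjugation + class correspondence off `T`. [cite: Rogawski1990, §14.2 p. 233] [cite: Omeara1963, §71 Thm. 71:18] -/
theorem exists_finset_rankTwo_levelMatching_diagonal (dJ : Fin 2 → L)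
    (hdJ : ∀ i, IsCMField.complexConj L (dJ i) = dJ i) (hdJ0 : ∀ i, dJ i ≠ 0)
    {δ : L} (hcδ : IsCMField.complexConj L δ = -δ) (hδ : δ ≠ 0)
    (hJh : ((Matrix.diagonal dJ).map (IsCMField.complexConj L))ᵀ = Matrix.diagonal dJ) (hJdet : (Matrix.diagonal dJ).det ≠ 0) :
    ∃ S₀ : Finset (HeightOneSpectrum (𝓞 ↥(maximalRealSubfield L))),
      {v : HeightOneSpectrum (𝓞 ↥(maximalRealSubfield L)) |
        ¬ Liu2021.LemD1.IsIsotropic (Liu2021.LemD1OfPlace.standingData L v (IsCMField.complexConj L) 2 (Matrix.diagonal dJ) hcδ hδ le_rfl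
          hJh hJdet)} ⊆ ↑S₀ ∧
      (∀ v ∉ S₀, ∃ ψ : (cmDatum L 2 (Matrix.diagonal dJ)).Local v ≃ₜ*
          (cmDatum L 2 (Matrix.of fun i j : Fin 2 => if i.val + j.val + 1 = 2 then (1 : L) else 0)).Local v,
        (∃ S : GL (Fin 2) (LocalRing L v), ∀ g : (cmDatum L 2 (Matrix.diagonal dJ)).Local v,
          ((ψ g).val : GL (Fin 2) (LocalRing L v)) = S⁻¹ * g.val * S) ∧
        (∀ γ' : (cmDatum L 2 (Matrix.diagonal dJ)).Local v,
          Corresponds (conjLocal L (IsCMField.complexConj L) v) ((adelicForm L 2 (Matrix.diagonal dJ)).map (adeleToLocal L v))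
            ((adelicForm L 2 (Matrix.of fun i j : Fin 2 => if i.val + j.val + 1 = 2 then (1 : L) else 0)).map (adeleToLocal L v))
            γ' (ψ γ')) ∧
        (∀ γ : (cmDatum L 2 (Matrix.of fun i j : Fin 2 => if i.val + j.val + 1 = 2 then (1 : L) else 0)).Local v,
          Corresponds (conjLocal L (IsCMField.complexConj L) v) ((adelicForm L 2 (Matrix.diagonal dJ)).map (adeleToLocal L v))
            ((adelicForm L 2 (Matrix.of fun i j : Fin 2 => if i.val + j.val + 1 = 2 then (1 : L) else 0)).map (adeleToLocal L v))
            (ψ.symm γ) γ) ∧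
        ∀ g, ψ g ∈ cmLocalIntegralLevel L 2 (Matrix.of fun i j : Fin 2 => if i.val + j.val + 1 = 2 then (1 : L) else 0) v ↔
          g ∈ cmLocalIntegralLevel L 2 (Matrix.diagonal dJ) v) ∧
      ∀ v, Liu2021.LemD1.IsIsotropic (Liu2021.LemD1OfPlace.standingData L v (IsCMField.complexConj L) 2 (Matrix.diagonal dJ) hcδ hδ le_rfl
          hJh hJdet) →
        ∃ (T : GL (Fin 2) (LocalRing L v)) (e : (cmDatum L 2 (Matrix.diagonal dJ)).Local v ≃ₜ*
            (cmDatum L 2 (Matrix.of fun i j : Fin 2 => if i.val + j.val + 1 = 2 then (1 : L) else 0)).Local v),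
          (∀ g : (cmDatum L 2 (Matrix.diagonal dJ)).Local v, ((e g).val : GL (Fin 2) (LocalRing L v)) = T⁻¹ * g.val * T) ∧
          (∀ γ' : (cmDatum L 2 (Matrix.diagonal dJ)).Local v,
            Corresponds (conjLocal L (IsCMField.complexConj L) v) ((adelicForm L 2 (Matrix.diagonal dJ)).map (adeleToLocal L v))
              ((adelicForm L 2 (Matrix.of fun i j : Fin 2 => if i.val + j.val + 1 = 2 then (1 : L) else 0)).map (adeleToLocal L v))
              γ' (e γ')) ∧
          ∀ γ : (cmDatum L 2 (Matrix.of fun i j : Fin 2 => if i.val + j.val + 1 = 2 then (1 : L) else 0)).Local v,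
            Corresponds (conjLocal L (IsCMField.complexConj L) v) ((adelicForm L 2 (Matrix.diagonal dJ)).map (adeleToLocal L v))
              ((adelicForm L 2 (Matrix.of fun i j : Fin 2 => if i.val + j.val + 1 = 2 then (1 : L) else 0)).map (adeleToLocal L v))
              (e.symm γ) γ := by
  -- the real diagonal `t` with `diag(dJ) = diag(t) ⊗ 1`, and `d := δ²` (as in ★ `RemD5CompanionParity`)
  let t : Fin 2 → maximalRealSubfield L := fun i => ⟨dJ i, (IsCMField.complexConj_eq_self_iff (K := L) (dJ i)).1 (hdJ i)⟩
  have hJ : Matrix.diagonal dJ = (Matrix.diagonal t).map (algebraMap (maximalRealSubfield L) L) := by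
    rw [Matrix.diagonal_map (map_zero _)]
    rfl
  have ht : ∀ i, t i ≠ 0 := fun i h => hdJ0 i (congrArg Subtype.val h)
  let d : maximalRealSubfield L :=
    ⟨δ * δ, (IsCMField.complexConj_eq_self_iff (K := L) (δ * δ)).1 (by rw [map_mul, hcδ, neg_mul_neg])⟩
  have hd : δ * δ = algebraMap (maximalRealSubfield L) L d := rfl
  have hH : ((Matrix.diagonal dJ).map (cmConjRingHom L))ᵀ = Matrix.diagonal dJ := by
    rw [map_cmConjRingHom_eq_map_complexConj]; exact hJh
  exact exists_finset_rankTwo_levelMatching_of_finite L (Matrix.diagonal dJ) hH hJdet hcδ hδ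
    (Liu2021.LemD1OfPlace.finite_setOf_not_isIsotropic L (IsCMField.complexConj L) hcδ hδ t hJ hJh hJdet hd ht)

end Package

end UnitaryGroup

end Literature.NumberTheory.Automorphic

end
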